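/-
Copyright: lit-balaban cell, Phase-2 proof seat p11 (gen 4).  Skeleton of a published paper; no claims beyond what the kernel checks.
-/
import Literature.MathematicalPhysics.QuantumFieldTheory.BalabanImbrieJaffe1984to88.BIJ85FluctuationCovarianceFlatBounds

/-!
# `BalabanImbrieJaffe1984to88.BIJ85ScalarFormSemigroup` — T. Bałaban, J. Imbrie, A. Jaffe, *Renormalization of the Higgs model:
minimizers, propagators and the stability of mean field theory*, Commun. Math. Phys. **97** (1985) 299–329 [BalabanImbrieJaffe1985]:
Sect. 4.6 p. 313 (*"The coefficients a_k are produced by iterating one-step renormalization transformations which use a constant a in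
the Gaussian"*) with Sect. 6.3 pp. 320–321 ((6.3.3): one more step integrates the unit-lattice scalar field against
`exp{−[S_k(u_k,φ) + ½a‖ψ − Q(u_k)φ‖²]}` and *"reproduces the (k+1) quadratic form for the action"*) — **THE RENORMALIZATION-GROUP
SEMIGROUP OF THE SCALAR QUADRATIC FORMS (4.6.4), PROVED AT EVERY `U(1)` BACKGROUND on the torus model of record**: for every `u`,
every `k ≥ 1` in the standing range and every block field `ψ` of the next level,
`inf_{ψ′} {⟨ψ′, Δ_k(u)ψ′⟩ + aL^{d−2}‖Q(u^{(k)})ψ′ − ψ‖²} = L^{d−2}⟨ψ, Δ_{k+1}(u)ψ⟩`, the infimum ATTAINED, with the printed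
`a_{k+1} = aa_k/(aL^{−2} + a_k)` ((2.13) of [3]) and the `η`-lattice kinetic normalization `c_{k+1}² = L^{−(d−2)}c_k²`; [3] =
T. Bałaban, *(Higgs)₂,₃ quantum fields in a finite volume I*, Commun. Math. Phys. **85** (1982) 603–626 [Balaban1982Higgs1], whose
(2.18) (inductive definition of `Δ^{(k+1)}` by ONE step from `Δ^{(k)}`) and (2.19)/(2.21) (closed form of `Δ^{(k)}` from the `k`-step
transformation (2.16)) this identity reconciles at the level of the quadratic forms.

statement-level skeleton of published theorems with citation tags; proofs where landed; nothing here is a claim about the Yang–Mills mass gap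

PDF held: `paper:balaban1985-cmp97-bij-higgs-minimizers` (journal page = PDF page + 298), p. 313 [PDF 15], pp. 320–321 [PDF 22–23];
[3] = `paper:balaban1982-cmp85-higgs23-i` (journal page = PDF page + 602), pp. 608–610 [PDF 6–8] (`lit read`, this session).

CITATION HEADER (lean-in-tree rule).  Phase-2 file of the lit-balaban TYPED SKELETON (HOME `run/shared/lean/pub/lit-balaban/`), seat p11
gen 4 (unit `lit-balaban-p11-g4`; TAKING line HOME/STATUS.md 2026-08-21T07:37:08Z; owner r15, referee ref-5; own lane = the C1 scalar sector
§4.6/§6.3).  WHAT IS REPRODUCED: row **C1.Eq4.6.2-4.6.4** (the `a_k` sentence, p. 313) and row **C1.Eq6.3.1-6.3.4** (p. 321 *"It reproduces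
the (k+1) quadratic form for the action"*), KNITTED with rows **B1.Eq2.17**/**B1.Eq2.21** (owner r14) — kind «model-instance» on the C1
carriers of record.  PRIOR ART IN THE TREE (consumed or paralleled, not restated): r14's `Balaban1983to89.B1RG242.display221_succ` is the
same reconciliation as an abstract MATRIX identity `β·1 − β²QC^{(k)}Q^* = γ·1 − γ²Q_{k+1}G_{k+1}Q^*_{k+1}` GIVEN that `C^{(k)} =
(βP + Δ^{(k)})^{−1}` exists; p34's `B1Eq221GaussStep` is the Gaussian-integral ↦ Schur-complement dictionary on r14's carriers; gen 3's
`BIJ85ScalarRTComposition` is (2.14)/(2.16) of [3] for the TRANSFORMATIONS (kernels).  NEW HERE: the VARIATIONAL form (an attained infimum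
over the intermediate field, no invertibility hypothesis on `aL^{d−2}P + Δ_k`) for the FORMS `Δ_k(u)` of (4.6.4) themselves
(`BIJ85ScalarForm464.deltaOp` on `FineSp`/`CoarseSpK`, gens 2–3), at every background, with the rescaling factor explicit.

THE PRINTED TEXT, verbatim.  C1 p. 313 [PDF 15]: *"The coefficients a_k are produced by iterating one-step renormalization
transformations which use a constant a in the Gaussian. This yields a_k = a(1 − L^{−2})(1 − L^{−2k})^{−1} in the k-step transformation
[3]. The quadratic form which arises for the scalar field is ⟨ψ, Δ_k(u_k)ψ⟩, where ψ is the unit lattice scalar field and where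
Δ_k(u_k) = a_kI − a_k²Q_k(u_k)G_k(u_k)Q_k^*(u_k). (4.6.4)"*  p. 320 [PDF 22]: *"The scalar field integral has the form
∫𝒟φ exp{−[S_k(u_k, φ) + ½a‖ψ − Q(u_k)φ‖²]}. (6.3.3)"*  p. 321 [PDF 23]: *"Now we are in exactly the same situation as [3]. We expand the
whole integrand with respect to H_kB and perform the fluctuation field integral over boson fields as in that paper. It reproduces the
(k+1) quadratic form for the action."*  [3] p. 608 [PDF 6]: *"t^{L^kε}_{a,L,A}(ψ(y), φ↾_{B(y)}) = (a(L^{k+1}ε)^{d−2}/2π)^{N/2}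
exp(−½a(L^{k+1}ε)^{d−2}|ψ(y) − (Q(A)φ)(y)|²) (2.6)"*; p. 609 [PDF 7]: *"An easy Gaussian integration gives the formula (2.12) … where a,
a_k, a_{k+1} satisfy the relation (2.13) … a_k = a(1 − L^{−2})/(1 − L^{−2k}), (2.15) Thus we get the following formula for the
composition of k successive renormalization transformations (2.16)"*; p. 610 [PDF 8]: *"We define inductively … Z^{(k),L^kε}(Ω,A)
exp(−½⟨ψ, Δ^{(k+1),L^{k+1}ε}(Ω,A)ψ⟩) = T^{L^kε}_{a,L,A}[Ω^{(k)}, exp(−½⟨φ, Δ^{(k),L^kε}(Ω,A)φ⟩)]. (2.18) From (2.16) we have … (2.19) …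
and calculating the integral in (2.19), we obtain ⟨ψ, Δ^{(k),L^kε}(Ω,A)ψ⟩ = a_k(L^kε)^{−2}⟨ψ,ψ⟩ − a_k²(L^kε)^{−4}⟨ψ, Q_k(A)G^ε_k(Ω,A)
Q^*_k(A)ψ⟩. (2.21)"*.

NORMALIZATION (read off (2.6)/(2.10)/(2.21) of [3] with the scalar products (1.5) of weight `(spacing)^d`, in the scaling where level
`j + k` is the unit lattice and level `j` the `η = L^{−k}` lattice, cf. (2.22) of [3] and C1 p. 313): the coefficient of the plain
`Σ_y|ψ(y) − (Q_kφ)(y)|²` is `a_k` (C1's (4.6.4), the carriers' unweighted `ℓ²` norms), the kinetic term is `c_k²Σ_b|u_bφ(b₊) − φ(b₋)|²` with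
`c_k² = η^{d−2} = L^{2k}/L^{kd}` (`BIJ85Ineq732Flat.cPhys`), and the one-step Gaussian (2.6) from the unit lattice to the `L`-lattice has the
coefficient `aL^{d−2}` of the plain `Σ_z|ψ(z) − (Qψ′)(z)|²`; passing to the scaling where level `j + k + 1` is the unit lattice divides the
whole form by `L^{d−2}` — the factor `t^{−1} = L^d/L²` below.

WHAT IS PROVED (0 `sorry`, standard axioms; theorems only, no new notion: `Q(W)^*` is r15's `BIJ85CellAverages.Cells.QcovStar` on r18's torus
instance `torusCells`).
* §1 (abstract real inner-product spaces) the ONE-STEP MINIMIZATION over the intermediate field — the variational content of (2.12)/(2.13)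
  of [3]: for a linear `Q` with `‖Qδ‖² ≤ N^{−1}‖δ‖²`, `α, β > 0`: `αNβ/(αN + β)·‖Qχ₀ − ψ‖² ≤ α‖χ − χ₀‖² + β‖Qχ − ψ‖²` for all `χ`
  (`oneStep_le`), with EQUALITY at an explicit `χ` when `Q` has a right inverse `E` with `‖Eθ‖² = N‖θ‖²` (`oneStep_attained`).
* §2 `Q(W)^*` on the carriers: `cells_qcovStar_apply`/`qCovStar_apply` ((Q(W)^*θ)(x) = conj(w(Γ_{yx}))θ(y)), `qlin_qCovStar`
  (`Q(W)Q(W)^* = 1`, (2.9), from r18's `qCov_qCovStar`), `norm_qCovStar_sq` (`‖Q(W)^*θ‖² = L^d‖θ‖²`).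
* §3 **`semigroup_le` / `semigroup_attained` / `semigroup_isLeast`** — EVERY `u`, every `k` with `j + k + 1 ≤ m + K`, all constants
  `α, β, t > 0`, `c`, with `α₁ = t·αL^dβ/(αL^d + β)`, `c₁² = tc²`, `G`/`G₁` the inverses (4.6.2) at `(c, Q_k(u), α)`/`(c₁, Q_{k+1}(u), α₁)`:
  `t^{−1}⟨ψ, Δ_{k+1}ψ⟩ = min_{ψ′} {⟨ψ′, Δ_kψ′⟩ + β‖Q(u^{(k)})ψ′ − ψ‖²}` (`Δ_k = deltaOp (QlinK u k) α G`, `Δ_{k+1} = deltaOp (QlinK u (k+1)) α₁ G₁`).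
  Mechanism: gen 2's (4.6.4)-as-a-minimum (`eq464_inf`, `inner_deltaOp_eq`: `⟨ψ, Δψ⟩ = min_φ α‖Q_kφ − ψ‖² + ‖D_cφ‖²`), §1 with `N = L^d`
  (`norm_Qlin_sq_le`, §2), the exchange of the two minimizations, and `Q(u^{(k)})Q_k(u) = Q_{k+1}(u)` (definitional, gen 3 `qCovK_succ`).
* §4 **the printed constants**: `aK_step` (r15's `a_k` satisfies `a_{k+1} = (L^d/L²)^{−1}·a_kL^d·aL^{d−2}/(a_kL^d + aL^{d−2})`, i.e. (2.13) of
  [3], from gen 2's `BIJ85CoefficientAk464.aK_succ_eq`), `cPhys_step` (`c_{k+1}² = (L^d/L²)^{−1}c_k²`), and **`semigroup_phys`** /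
  **`iInf_phys`**: for `k ≥ 1`, `a > 0`, every `u`:
  `⨅_{ψ′} (⟨ψ′, Δ_k(u)ψ′⟩ + a(L^d/L²)‖Q(u^{(k)})ψ′ − ψ‖²) = (L^d/L²)·⟨ψ, Δ_{k+1}(u)ψ⟩` with `Δ_k(u)` AT THE PRINTED `a_k`, `c_k` and
  `Δ_{k+1}(u)` AT THE PRINTED `a_{k+1}`, `c_{k+1}` — *"It reproduces the (k+1) quadratic form"*.
HONEST SCOPE.  Quadratic (Gaussian) part only: the non-quadratic parts of `S_k`, the gauge transformation `ω` of (6.3.1)–(6.3.4) (see gen 3's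
`inner_deltaOp_gaugeAct` for the covariance (6.3.2) of the form) and the fluctuation integral itself (determinants/normalisations `Z`, r14/p34)
are not touched; the inverses `G_k(u)` enter as hypotheses `hG` (they exist for every `u`: gen 3's `BIJ85ScalarPropagatorTorusK.exists_GK`).
-/

open scoped RealInnerProductSpace BigOperators
open Finset

namespace Literature.MathematicalPhysics.QuantumFieldTheory.BalabanImbrieJaffe1984to88.BIJ85ScalarFormSemigroup

open Literature.MathematicalPhysics.QuantumFieldTheory.Balaban1983to89
open BIJ88Sect3Statements (U1 toC cfg covD)
open BIJ85Sect1Model (HiggsField)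
open BIJ85BlockAveragesTorus BIJ85BlockAveragesTorusK BIJ85ScalarPropagatorTorus BIJ85ScalarPropagatorTorusK
open BIJ85ScalarForm464 BIJ85Eq461Proof BIJ85BlockAveragingIneq BIJ85Ineq732Flat BIJ85FluctuationCovariance
open BIJ85FluctuationCovarianceFlatBounds

noncomputable section

/-! ## §1 The one-step minimization over the intermediate field (abstract) — the variational content of (2.12)/(2.13) of [3] -/

section Abstract

variable {Φ₁ Φ₂ : Type*} [NormedAddCommGroup Φ₁] [InnerProductSpace ℝ Φ₁] [NormedAddCommGroup Φ₂] [InnerProductSpace ℝ Φ₂]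

/-- kernel ("parallel resistors"): `AB/(A + B)·‖w‖² ≤ A‖s‖² + B‖s − w‖²` for `A, B > 0`, by completing the square
`A‖s‖² + B‖s − w‖² − AB/(A+B)‖w‖² = (A + B)‖s − (B/(A+B))w‖²`. [folklore] -/
private theorem resistor_le {A B : ℝ} (hA : 0 < A) (hB : 0 < B) (s w : Φ₂) :
    A * B / (A + B) * ‖w‖ ^ 2 ≤ A * ‖s‖ ^ 2 + B * ‖s - w‖ ^ 2 := by
  have hAB : 0 < A + B := add_pos hA hB
  have key : A * ‖s‖ ^ 2 + B * ‖s - w‖ ^ 2 - A * B / (A + B) * ‖w‖ ^ 2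
      = (A + B) * ‖s - (B / (A + B)) • w‖ ^ 2 := by
    rw [@norm_sub_sq_real, @norm_sub_sq_real, norm_smul, mul_pow, Real.norm_eq_abs, sq_abs, inner_smul_right]
    field_simp
    ring
  nlinarith [key, mul_nonneg hAB.le (sq_nonneg ‖s - (B / (A + B)) • w‖)]

/-- kernel: the minimum of `A‖s‖² + B‖s − w‖²` is attained at `s = (B/(A+B))w` with value `AB/(A+B)·‖w‖²`. [folklore] -/
private theorem resistor_eq {A B : ℝ} (hA : 0 < A) (hB : 0 < B) (w : Φ₂) :
    A * ‖(B / (A + B)) • w‖ ^ 2 + B * ‖(B / (A + B)) • w - w‖ ^ 2 = A * B / (A + B) * ‖w‖ ^ 2 := by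
  have hAB : 0 < A + B := add_pos hA hB
  have h1 : (B / (A + B)) • w - w = (-(A / (A + B))) • w := by
    rw [show (B / (A + B)) • w - w = (B / (A + B) - 1) • w by rw [sub_smul, one_smul]]
    congr 1
    field_simp
    ring
  rw [h1, norm_smul, norm_smul, mul_pow, mul_pow, Real.norm_eq_abs, Real.norm_eq_abs, sq_abs, sq_abs]
  field_simp
  ring

/-- **One step, lower bound** — the exponent of the Gaussian integral (2.12) of [3] bounded below by its critical value: for a linear
averaging `Q` with `‖Qδ‖² ≤ N^{−1}‖δ‖²` (the covariant averages: `N = L^d`, (2.9)) and `α, β > 0`,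
`αNβ/(αN + β)·‖Qχ₀ − ψ‖² ≤ α‖χ − χ₀‖² + β‖Qχ − ψ‖²` for every intermediate field `χ` — the composed constant `αNβ/(αN + β)` is (2.13).
[cite: Balaban1982Higgs1, (2.12)-(2.13) p.609] -/
theorem oneStep_le (Q : Φ₁ →ₗ[ℝ] Φ₂) {N : ℝ} (hN : 0 < N) (hQ : ∀ δ, ‖Q δ‖ ^ 2 ≤ N⁻¹ * ‖δ‖ ^ 2) {α β : ℝ}
    (hα : 0 < α) (hβ : 0 < β) (χ₀ χ : Φ₁) (ψ : Φ₂) :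
    α * N * β / (α * N + β) * ‖Q χ₀ - ψ‖ ^ 2 ≤ α * ‖χ - χ₀‖ ^ 2 + β * ‖Q χ - ψ‖ ^ 2 := by
  have h1 : α * N * ‖Q (χ - χ₀)‖ ^ 2 ≤ α * ‖χ - χ₀‖ ^ 2 := by
    have h := mul_le_mul_of_nonneg_left (hQ (χ - χ₀)) (mul_pos hα hN).le
    calc α * N * ‖Q (χ - χ₀)‖ ^ 2 ≤ α * N * (N⁻¹ * ‖χ - χ₀‖ ^ 2) := h
      _ = α * ‖χ - χ₀‖ ^ 2 := by field_simp
  have h2 := resistor_le (mul_pos hα hN) hβ (Q (χ - χ₀)) (ψ - Q χ₀)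
  have h3 : Q (χ - χ₀) - (ψ - Q χ₀) = Q χ - ψ := by rw [map_sub]; abel
  rw [h3, norm_sub_rev ψ] at h2
  linarith

/-- **One step, the minimum is attained** (the critical point of the Gaussian integral (2.12) of [3]): if moreover `Q` has a right inverse
`E` (`QE = 1`) with `‖Eθ‖² = N‖θ‖²` (the covariant block-constant extension `Q^*`, (2.9)), then
`min_χ {α‖χ − χ₀‖² + β‖Qχ − ψ‖²} = αNβ/(αN + β)·‖Qχ₀ − ψ‖²`, attained at `χ = χ₀ + E(β/(αN+β)·(ψ − Qχ₀))`.
[cite: Balaban1982Higgs1, (2.12)-(2.13) p.609] -/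
theorem oneStep_attained (Q : Φ₁ →ₗ[ℝ] Φ₂) {N : ℝ} (hN : 0 < N) (E : Φ₂ → Φ₁) (hQE : ∀ θ, Q (E θ) = θ)
    (hE : ∀ θ, ‖E θ‖ ^ 2 = N * ‖θ‖ ^ 2) {α β : ℝ} (hα : 0 < α) (hβ : 0 < β) (χ₀ : Φ₁) (ψ : Φ₂) :
    ∃ χ : Φ₁, α * ‖χ - χ₀‖ ^ 2 + β * ‖Q χ - ψ‖ ^ 2 = α * N * β / (α * N + β) * ‖Q χ₀ - ψ‖ ^ 2 := by
  refine ⟨χ₀ + E ((β / (α * N + β)) • (ψ - Q χ₀)), ?_⟩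
  rw [add_sub_cancel_left, hE, map_add, hQE, norm_sub_rev (Q χ₀) ψ,
    show Q χ₀ + (β / (α * N + β)) • (ψ - Q χ₀) - ψ = (β / (α * N + β)) • (ψ - Q χ₀) - (ψ - Q χ₀) by abel,
    ← mul_assoc, resistor_eq (mul_pos hα hN) hβ]

end Abstract

/-! ## §2 `Q(W)^*` on the carriers of record: the covariant block-constant extension (r15's `Cells.QcovStar`, torus instance) -/

variable {P : Params} {i j : ℕ}

/-- kernel (r15's `Q^*` pointwise, abstract cells; the computation inside r15's `Cells.Qcov_QcovStar`): for `x ∈ B(y)`,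
`(Q^*ψ)(x) = τ_x^{−1}ψ(y)`. [cite: BalabanImbrieJaffe1985, (2.9) p.303] -/
theorem cells_qcovStar_apply (G : BIJ85CellAverages.Cells) (τ : G.F → Circle) (ψ : G.C → ℂ) {x : G.F} {y : G.C} (hx : x ∈ G.B y) :
    G.QcovStar τ ψ x = (((τ x)⁻¹ : Circle) : ℂ) * ψ y := by
  classical
  unfold BIJ85CellAverages.Cells.QcovStar
  rw [Finset.sum_eq_single y]
  · simp [hx]
  · intro y' _ hne
    have : x ∉ G.B y' := fun h' => hne (G.B_unique h' hx)
    simp [this]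
  · intro hy
    exact absurd (Finset.mem_univ y) hy

/-- kernel: on the torus, r15's `Q(W)^*` (`Cells.QcovStar` for r18's instance `torusCells` with the transports `w(Γ_{yx})`) is the covariant
block-constant extension `(Q(W)^*θ)(x) = conj(w(Γ_{yx}))·θ(y)`, `y` the block of `x`. [cite: BalabanImbrieJaffe1985, (2.9) p.303] -/
theorem qCovStar_apply (W : GaugeField P i U1) (θ : HiggsField P (i+1)) (x : Balaban1983to89.Site P i) :
    (torusCells P i).QcovStar (holCircle W) θ x = (starRingEnd ℂ) (holC W x) * θ (blockOf x) := by
  have hx : x ∈ (torusCells P i).B (blockOf x) := ((torusCells P i).mem_B (blockOf x) x).2 rfl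
  rw [cells_qcovStar_apply (torusCells P i) (holCircle W) θ hx, Circle.coe_inv_eq_conj, coe_holCircle]

/-- **(2.9) `Q(W)Q(W)^* = I`** on the carriers (`Qlin W` after `Q(W)^*` is the identity of the block fields), for EVERY transport field `W` —
r18's `qCov_qCovStar`. [cite: BalabanImbrieJaffe1985, (2.9) p.303] -/
theorem qlin_qCovStar (hi : i + 1 ≤ P.m + P.K) (W : GaugeField P i U1) (θ : CoarseSp P i) :
    Qlin W (WithLp.toLp 2 ((torusCells P i).QcovStar (holCircle W) (WithLp.ofLp θ))) = θ := by
  ext y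
  rw [Qlin_apply]
  exact qCov_qCovStar hi W _ y

/-- **(2.9), `Q` a partial isometry**, read in the unweighted `ℓ²` norms of the carriers: `‖Q(W)^*θ‖² = L^d‖θ‖²` (each of the `L^d` sites of
a block carries `|θ(y)|`, the transports having modulus one). [cite: BalabanImbrieJaffe1985, (2.9) p.303] -/
theorem norm_qCovStar_sq (hi : i + 1 ≤ P.m + P.K) (W : GaugeField P i U1) (θ : CoarseSp P i) :
    ‖(WithLp.toLp 2 ((torusCells P i).QcovStar (holCircle W) (WithLp.ofLp θ)) : FineSp P i)‖ ^ 2 = (P.L : ℝ) ^ P.d * ‖θ‖ ^ 2 := by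
  set E : FineSp P i := WithLp.toLp 2 ((torusCells P i).QcovStar (holCircle W) (WithLp.ofLp θ)) with hE
  rw [← sum_norm_sq_eq E, ← sum_norm_sq_eq θ,
    ← sum_fiberwise univ (fun x : Balaban1983to89.Site P i => blockOf x) (fun x => ‖E x‖ ^ 2), mul_sum]
  refine sum_congr rfl fun y _ => ?_
  have h : ∀ x ∈ block y, ‖E x‖ ^ 2 = ‖θ y‖ ^ 2 := by
    intro x hx
    rw [mem_block_iff] at hx
    rw [show E x = (starRingEnd ℂ) (holC W x) * θ (blockOf x) from qCovStar_apply W _ x, norm_mul, RCLike.norm_conj, norm_holC,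
      one_mul, hx]
  show ∑ x ∈ block y, ‖E x‖ ^ 2 = _
  rw [sum_congr rfl h, sum_const, Balaban1983to89.Site.card_block hi, nsmul_eq_mul, Nat.cast_pow]

/-! ## §3 The semigroup identity at every background -/

/-- kernel: `‖D_{c₁,u}φ‖² = t‖D_{c,u}φ‖²` when `c₁² = tc²` (the kinetic normalization rescales). [cite: BalabanImbrieJaffe1985, (4.6.3) p.313] -/
theorem norm_Dlin_sq_scale {c c₁ t : ℝ} (hc₁ : c₁ ^ 2 = t * c ^ 2) (U : GaugeField P j U1) (φ : FineSp P j) :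
    ‖Dlin c₁ U φ‖ ^ 2 = t * ‖Dlin c U φ‖ ^ 2 := by
  rw [norm_Dlin_sq, norm_Dlin_sq, mul_sum]
  refine sum_congr rfl fun b _ => ?_
  rw [norm_mul, norm_mul, mul_pow, mul_pow, Complex.norm_real, Complex.norm_real, Real.norm_eq_abs, Real.norm_eq_abs, sq_abs,
    sq_abs, hc₁, mul_assoc]

/-- kernel: `Q(u^{(k)})Q_k(u) = Q_{k+1}(u)` as linear maps of the carriers (gen 3's `qCovK_succ`, definitional).
[cite: BalabanImbrieJaffe1985, (4.6.4) p.313] -/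
theorem qlin_qlinK (U : GaugeField P j U1) (k : ℕ) (φ : FineSp P j) :
    Qlin (lineIter U k) (QlinK U k φ) = QlinK U (k+1) φ := by
  ext y
  rfl

/-- **SEMIGROUP OF THE SCALAR FORMS, lower bound, EVERY background**: with `α₁ = t·αL^dβ/(αL^d + β)`, `c₁² = tc²`, `G`, `G₁` the inverses
(4.6.2) at `(c, Q_k(u), α)`, `(c₁, Q_{k+1}(u), α₁)`:  `t^{−1}⟨ψ, Δ_{k+1}(u)ψ⟩ ≤ ⟨ψ′, Δ_k(u)ψ′⟩ + β‖Q(u^{(k)})ψ′ − ψ‖²` for every intermediate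
unit-lattice field `ψ′` — (2.18) of [3] ((k+1)-form = one step applied to the k-form) against (2.19)/(2.21) (its closed form), the `≤` half.
[cite: BalabanImbrieJaffe1985, (4.6.4) p.313] -/
theorem semigroup_le {k : ℕ} (hk : j + k + 1 ≤ P.m + P.K) (U : GaugeField P j U1) {c c₁ α α₁ β t : ℝ} (hα : 0 < α)
    (hβ : 0 < β) (ht : 0 < t) (hα₁ : α₁ = t * (α * (P.L : ℝ) ^ P.d * β / (α * (P.L : ℝ) ^ P.d + β)))
    (hc₁ : c₁ ^ 2 = t * c ^ 2) {G : FineSp P j →ₗ[ℝ] FineSp P j} (hG : ∀ φ, opT (Dlin c U) (QlinK U k) α (G φ) = φ)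
    {G₁ : FineSp P j →ₗ[ℝ] FineSp P j} (hG₁ : ∀ φ, opT (Dlin c₁ U) (QlinK U (k+1)) α₁ (G₁ φ) = φ)
    (ψ : CoarseSpK P j (k+1)) (ψ' : CoarseSpK P j k) :
    t⁻¹ * ⟪ψ, deltaOp (QlinK U (k+1)) α₁ G₁ ψ⟫
      ≤ ⟪ψ', deltaOp (QlinK U k) α G ψ'⟫ + β * ‖Qlin (lineIter U k) ψ' - ψ‖ ^ 2 := by
  have hN : (0 : ℝ) < (P.L : ℝ) ^ P.d := by have := three_le_L P; positivity
  subst hα₁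
  set φ' := phiCl (QlinK U k) α G ψ' with hφ'
  have hk' := inner_deltaOp_eq (D := Dlin c U) hG ψ'
  have h1 := oneStep_le (Qlin (lineIter U k) : CoarseSpK P j k →ₗ[ℝ] CoarseSpK P j (k+1)) hN
    (fun δ => norm_Qlin_sq_le (i := j + k) hk (lineIter U k) δ) hα hβ (QlinK U k φ') ψ' ψ
  rw [qlin_qlinK, norm_sub_rev ψ'] at h1
  have hα₁' : 0 ≤ t * (α * (P.L : ℝ) ^ P.d * β / (α * (P.L : ℝ) ^ P.d + β)) := by positivity
  have h2 := eq464_inf (D := Dlin c₁ U) hG₁ hα₁' ψ φ'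
  rw [scalarForm, norm_Dlin_sq_scale hc₁] at h2
  rw [inv_mul_le_iff₀ ht]
  nlinarith [h2, h1, hk', mul_le_mul_of_nonneg_left h1 ht.le]

/-- **SEMIGROUP OF THE SCALAR FORMS, the infimum is attained, EVERY background** (same data as `semigroup_le`): some intermediate field
`ψ′` achieves `⟨ψ′, Δ_k(u)ψ′⟩ + β‖Q(u^{(k)})ψ′ − ψ‖² = t^{−1}⟨ψ, Δ_{k+1}(u)ψ⟩` — namely `ψ′ = ` the one-step critical point over the
block-constant extension `Q(u^{(k)})^*` (§2) of the (k+1)-minimizer `ψ_{k+1} = α₁G₁Q_{k+1}^*ψ`. [cite: BalabanImbrieJaffe1985, (4.6.4) p.313] -/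
theorem semigroup_attained {k : ℕ} (hk : j + k + 1 ≤ P.m + P.K) (U : GaugeField P j U1) {c c₁ α α₁ β t : ℝ} (hα : 0 < α)
    (hβ : 0 < β) (ht : 0 < t) (hα₁ : α₁ = t * (α * (P.L : ℝ) ^ P.d * β / (α * (P.L : ℝ) ^ P.d + β)))
    (hc₁ : c₁ ^ 2 = t * c ^ 2) {G : FineSp P j →ₗ[ℝ] FineSp P j} (hG : ∀ φ, opT (Dlin c U) (QlinK U k) α (G φ) = φ)
    {G₁ : FineSp P j →ₗ[ℝ] FineSp P j} (hG₁ : ∀ φ, opT (Dlin c₁ U) (QlinK U (k+1)) α₁ (G₁ φ) = φ)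
    (ψ : CoarseSpK P j (k+1)) :
    ∃ ψ' : CoarseSpK P j k, ⟪ψ', deltaOp (QlinK U k) α G ψ'⟫ + β * ‖Qlin (lineIter U k) ψ' - ψ‖ ^ 2
      = t⁻¹ * ⟪ψ, deltaOp (QlinK U (k+1)) α₁ G₁ ψ⟫ := by
  have hN : (0 : ℝ) < (P.L : ℝ) ^ P.d := by have := three_le_L P; positivity
  subst hα₁
  set φ₁ := phiCl (QlinK U (k+1)) (t * (α * (P.L : ℝ) ^ P.d * β / (α * (P.L : ℝ) ^ P.d + β))) G₁ ψ with hφ₁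
  have hk1 := inner_deltaOp_eq (D := Dlin c₁ U) hG₁ ψ
  rw [norm_Dlin_sq_scale hc₁] at hk1
  obtain ⟨ψ', hψ'⟩ := oneStep_attained (Qlin (lineIter U k) : CoarseSpK P j k →ₗ[ℝ] CoarseSpK P j (k+1)) hN
    (fun θ => WithLp.toLp 2 ((torusCells P (j + k)).QcovStar (holCircle (lineIter U k)) (WithLp.ofLp θ)))
    (qlin_qCovStar (i := j + k) hk (lineIter U k)) (norm_qCovStar_sq (i := j + k) hk (lineIter U k)) hα hβ (QlinK U k φ₁) ψ
  rw [qlin_qlinK, norm_sub_rev ψ'] at hψ'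
  refine ⟨ψ', le_antisymm ?_ (semigroup_le hk U hα hβ ht rfl hc₁ hG hG₁ ψ ψ')⟩
  have h2 := eq464_inf (D := Dlin c U) hG hα.le ψ' φ₁
  rw [scalarForm] at h2
  have e : t * (α * ‖QlinK U k φ₁ - ψ'‖ ^ 2 + β * ‖Qlin (lineIter U k) ψ' - ψ‖ ^ 2)
      = t * (α * (P.L : ℝ) ^ P.d * β / (α * (P.L : ℝ) ^ P.d + β) * ‖QlinK U (k+1) φ₁ - ψ‖ ^ 2) := by rw [hψ']
  rw [le_inv_mul_iff₀ ht]
  nlinarith [h2, hψ', hk1, e, mul_le_mul_of_nonneg_left h2 ht.le]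

/-- **SEMIGROUP OF THE SCALAR FORMS as an attained infimum, EVERY background** (general constants): `t^{−1}⟨ψ, Δ_{k+1}(u)ψ⟩` IS THE LEAST
value of `ψ′ ↦ ⟨ψ′, Δ_k(u)ψ′⟩ + β‖Q(u^{(k)})ψ′ − ψ‖²` — the quadratic form produced from `⟨·, Δ_k(u)·⟩` by one more Gaussian step (2.18)
is the closed form (2.21) at `k + 1` with the composed constant. [cite: BalabanImbrieJaffe1985, (4.6.4) p.313] -/
theorem semigroup_isLeast {k : ℕ} (hk : j + k + 1 ≤ P.m + P.K) (U : GaugeField P j U1) {c c₁ α α₁ β t : ℝ} (hα : 0 < α)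
    (hβ : 0 < β) (ht : 0 < t) (hα₁ : α₁ = t * (α * (P.L : ℝ) ^ P.d * β / (α * (P.L : ℝ) ^ P.d + β)))
    (hc₁ : c₁ ^ 2 = t * c ^ 2) {G : FineSp P j →ₗ[ℝ] FineSp P j} (hG : ∀ φ, opT (Dlin c U) (QlinK U k) α (G φ) = φ)
    {G₁ : FineSp P j →ₗ[ℝ] FineSp P j} (hG₁ : ∀ φ, opT (Dlin c₁ U) (QlinK U (k+1)) α₁ (G₁ φ) = φ)
    (ψ : CoarseSpK P j (k+1)) :
    IsLeast (Set.range fun ψ' : CoarseSpK P j k => ⟪ψ', deltaOp (QlinK U k) α G ψ'⟫ + β * ‖Qlin (lineIter U k) ψ' - ψ‖ ^ 2)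
      (t⁻¹ * ⟪ψ, deltaOp (QlinK U (k+1)) α₁ G₁ ψ⟫) := by
  constructor
  · obtain ⟨ψ', h⟩ := semigroup_attained hk U hα hβ ht hα₁ hc₁ hG hG₁ ψ
    exact ⟨ψ', h⟩
  · rintro _ ⟨ψ', rfl⟩
    exact semigroup_le hk U hα hβ ht hα₁ hc₁ hG hG₁ ψ ψ'

/-! ## §4 The printed constants: `a_k ↦ a_{k+1}` ((2.13) of [3]) and the `η`-lattice normalization -/

/-- kernel: r15's printed `a_k = a(1 − L^{−2})(1 − L^{−2k})^{−1}` satisfies the recursion (2.13) of [3] IN THE SEMIGROUP'S SHAPE,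
`a_{k+1} = (L^d/L²)^{−1}·(a_kL^d·a(L^d/L²))/(a_kL^d + a(L^d/L²))` (= `aa_k/(aL^{−2} + a_k)`, gen 2's `BIJ85CoefficientAk464.aK_succ_eq`), `k ≥ 1`.
[cite: BalabanImbrieJaffe1985, (4.6.4) p.313] -/
theorem aK_step {a : ℝ} (ha : 0 < a) (P : Params) {k : ℕ} (hk1 : 1 ≤ k) :
    BIJ85Sect4Statements.aK a P.L (k+1)
      = ((P.L : ℝ) ^ P.d / (P.L : ℝ) ^ 2)⁻¹ * (BIJ85Sect4Statements.aK a P.L k * (P.L : ℝ) ^ P.d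
          * (a * ((P.L : ℝ) ^ P.d / (P.L : ℝ) ^ 2))
          / (BIJ85Sect4Statements.aK a P.L k * (P.L : ℝ) ^ P.d + a * ((P.L : ℝ) ^ P.d / (P.L : ℝ) ^ 2))) := by
  have hL : (1 : ℝ) < P.L := by linarith [three_le_L P]
  have hL0 : (0 : ℝ) < P.L := by linarith
  have haK := (BIJ85CoefficientAk464.aK_pos_le ha hL hk1).1
  rw [BIJ85CoefficientAk464.aK_succ_eq ha hL hk1]
  field_simp
  ring

/-- kernel: the `η`-lattice kinetic normalization `c_k² = L^{2k}/L^{kd}` (`BIJ85Ineq732Flat.cPhys`) rescales by `c_{k+1}² = (L^d/L²)^{−1}c_k²`.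
[cite: BalabanImbrieJaffe1985, (4.6.3) p.313] -/
theorem cPhys_step (P : Params) (k : ℕ) :
    cPhys P (k+1) ^ 2 = ((P.L : ℝ) ^ P.d / (P.L : ℝ) ^ 2)⁻¹ * cPhys P k ^ 2 := by
  have hL0 : (0 : ℝ) < P.L := by linarith [three_le_L P]
  rw [cPhys_sq, cPhys_sq]
  field_simp
  ring

/-- **THE RG SEMIGROUP OF THE SCALAR QUADRATIC FORM (4.6.4) WITH THE PRINTED CONSTANTS, EVERY `U(1)` BACKGROUND** — *"The coefficients a_k
are produced by iterating one-step renormalization transformations which use a constant a in the Gaussian"* / *"It reproduces the (k+1)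
quadratic form for the action"*: for `k ≥ 1`, `j + k + 1 ≤ m + K`, `a > 0`, every `u`, with `Δ_k(u) = a_kI − a_k²Q_k(u)G_k(u)Q_k^*(u)` at
the printed `a_k` and `G_k(u) = [D^*_{c_k,u}D_{c_k,u} + a_kQ_k^*Q_k]^{−1}` (`c_k = cPhys`), and `Δ_{k+1}(u)` likewise at `a_{k+1}`, `c_{k+1}`:
`(L^d/L²)·⟨ψ, Δ_{k+1}(u)ψ⟩` IS THE LEAST VALUE of `ψ′ ↦ ⟨ψ′, Δ_k(u)ψ′⟩ + a(L^d/L²)‖Q(u^{(k)})ψ′ − ψ‖²` (one more step (2.6)/(6.3.3) with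
the constant `a`, then the rescaling to the next unit lattice). [cite: BalabanImbrieJaffe1985, (4.6.4) p.313, (6.3.3) p.320] -/
theorem semigroup_phys {k : ℕ} (hk1 : 1 ≤ k) (hk : j + k + 1 ≤ P.m + P.K) (U : GaugeField P j U1) {a : ℝ} (ha : 0 < a)
    {G : FineSp P j →ₗ[ℝ] FineSp P j}
    (hG : ∀ φ, opT (Dlin (cPhys P k) U) (QlinK U k) (BIJ85Sect4Statements.aK a P.L k) (G φ) = φ)
    {G₁ : FineSp P j →ₗ[ℝ] FineSp P j}
    (hG₁ : ∀ φ, opT (Dlin (cPhys P (k+1)) U) (QlinK U (k+1)) (BIJ85Sect4Statements.aK a P.L (k+1)) (G₁ φ) = φ)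
    (ψ : CoarseSpK P j (k+1)) :
    IsLeast (Set.range fun ψ' : CoarseSpK P j k =>
        ⟪ψ', deltaOp (QlinK U k) (BIJ85Sect4Statements.aK a P.L k) G ψ'⟫
          + a * ((P.L : ℝ) ^ P.d / (P.L : ℝ) ^ 2) * ‖Qlin (lineIter U k) ψ' - ψ‖ ^ 2)
      ((P.L : ℝ) ^ P.d / (P.L : ℝ) ^ 2 * ⟪ψ, deltaOp (QlinK U (k+1)) (BIJ85Sect4Statements.aK a P.L (k+1)) G₁ ψ⟫) := by
  have hL : (1 : ℝ) < P.L := by linarith [three_le_L P]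
  have hr : (0 : ℝ) < (P.L : ℝ) ^ P.d / (P.L : ℝ) ^ 2 := by positivity
  have hα := (BIJ85CoefficientAk464.aK_pos_le ha hL hk1).1
  have h := semigroup_isLeast hk U hα (mul_pos ha hr) (inv_pos.2 hr) (aK_step ha P hk1) (cPhys_step P k) hG hG₁ ψ
  rwa [inv_inv] at h

/-- **… as an equation for the infimum**: `⨅_{ψ′} (⟨ψ′, Δ_k(u)ψ′⟩ + a(L^d/L²)‖Q(u^{(k)})ψ′ − ψ‖²) = (L^d/L²)·⟨ψ, Δ_{k+1}(u)ψ⟩` (printed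
constants, every `u`, `k ≥ 1`). [cite: BalabanImbrieJaffe1985, (4.6.4) p.313, (6.3.3) p.320] -/
theorem iInf_phys {k : ℕ} (hk1 : 1 ≤ k) (hk : j + k + 1 ≤ P.m + P.K) (U : GaugeField P j U1) {a : ℝ} (ha : 0 < a)
    {G : FineSp P j →ₗ[ℝ] FineSp P j}
    (hG : ∀ φ, opT (Dlin (cPhys P k) U) (QlinK U k) (BIJ85Sect4Statements.aK a P.L k) (G φ) = φ)
    {G₁ : FineSp P j →ₗ[ℝ] FineSp P j}
    (hG₁ : ∀ φ, opT (Dlin (cPhys P (k+1)) U) (QlinK U (k+1)) (BIJ85Sect4Statements.aK a P.L (k+1)) (G₁ φ) = φ)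
    (ψ : CoarseSpK P j (k+1)) :
    (⨅ ψ' : CoarseSpK P j k, (⟪ψ', deltaOp (QlinK U k) (BIJ85Sect4Statements.aK a P.L k) G ψ'⟫
          + a * ((P.L : ℝ) ^ P.d / (P.L : ℝ) ^ 2) * ‖Qlin (lineIter U k) ψ' - ψ‖ ^ 2))
      = (P.L : ℝ) ^ P.d / (P.L : ℝ) ^ 2 * ⟪ψ, deltaOp (QlinK U (k+1)) (BIJ85Sect4Statements.aK a P.L (k+1)) G₁ ψ⟫ :=
  (semigroup_phys hk1 hk U ha hG hG₁ ψ).csInf_eq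

/-- **COROLLARY, no inverse left as a datum**: with THE inverses `G_k(u)`, `G_{k+1}(u)` of (4.6.2) (they exist for every `u`: gen 3's
`exists_GK`), the value `(L^d/L²)·⟨ψ, Δ_{k+1}(u)ψ⟩` is achieved by some intermediate field and bounds all of them from below — for every
`U(1)` field `u`, `a > 0`, `k ≥ 1`, `j + k + 1 ≤ m + K`. [cite: BalabanImbrieJaffe1985, (4.6.4) p.313, (6.3.3) p.320] -/
theorem semigroup_phys_exists {k : ℕ} (hk1 : 1 ≤ k) (hk : j + k + 1 ≤ P.m + P.K) (U : GaugeField P j U1) {a : ℝ} (ha : 0 < a)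
    (ψ : CoarseSpK P j (k+1)) :
    ∃ G G₁ : FineSp P j →ₗ[ℝ] FineSp P j,
      (∀ φ, opT (Dlin (cPhys P k) U) (QlinK U k) (BIJ85Sect4Statements.aK a P.L k) (G φ) = φ) ∧
      (∀ φ, opT (Dlin (cPhys P (k+1)) U) (QlinK U (k+1)) (BIJ85Sect4Statements.aK a P.L (k+1)) (G₁ φ) = φ) ∧
      IsLeast (Set.range fun ψ' : CoarseSpK P j k =>
          ⟪ψ', deltaOp (QlinK U k) (BIJ85Sect4Statements.aK a P.L k) G ψ'⟫
            + a * ((P.L : ℝ) ^ P.d / (P.L : ℝ) ^ 2) * ‖Qlin (lineIter U k) ψ' - ψ‖ ^ 2)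
        ((P.L : ℝ) ^ P.d / (P.L : ℝ) ^ 2 * ⟪ψ, deltaOp (QlinK U (k+1)) (BIJ85Sect4Statements.aK a P.L (k+1)) G₁ ψ⟫) := by
  have hL : (1 : ℝ) < P.L := by linarith [three_le_L P]
  have hk0 : j + k ≤ P.m + P.K := by omega
  obtain ⟨G, hG, -⟩ := exists_GK hk0 (cPhys_pos P k).ne' (BIJ85CoefficientAk464.aK_pos_le ha hL hk1).1 U
  obtain ⟨G₁, hG₁, -⟩ := exists_GK (k := k + 1) (by omega) (cPhys_pos P (k+1)).ne'
    (BIJ85CoefficientAk464.aK_pos_le ha hL (by omega : 1 ≤ k + 1)).1 U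
  exact ⟨G, G₁, hG, hG₁, semigroup_phys hk1 hk U ha hG hG₁ ψ⟩

end

end Literature.MathematicalPhysics.QuantumFieldTheory.BalabanImbrieJaffe1984to88.BIJ85ScalarFormSemigroup
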